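import Literature.AlgebraicGeometry.Frobenioids.BiratFrobeniusNormalizedCriterion
import Literature.AlgebraicGeometry.Frobenioids.ArchimedeanFrobeniusType
import Literature.AlgebraicGeometry.Frobenioids.ArchimedeanMorphismTypes
import Literature.AlgebraicGeometry.Frobenioids.ArchimedeanFrobenioidRelative
import Literature.AlgebraicGeometry.Frobenioids.ArchimedeanStandardTypeProofs
import Literature.AlgebraicGeometry.Frobenioids.FiberProductsObjects
import Literature.AlgebraicGeometry.Frobenioids.ModelFrobenioidModelType
import Literature.AlgebraicGeometry.Frobenioids.BiratLocalization
import HarnessLib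

/-!
# Frobenioids II, Theorem 3.6 (i): the archimedean Frobenioid `C` (`= C^ℤ`) is of birationally
# Frobenius-normalized type AT THE birationalization — PROOF ("immediate from the construction of `C^Λ`")

Mochizuki, *The geometry of Frobenioids II: poly-Frobenioids*, Kyushu J. Math. **62** (2008)
401–460, §3, Theorem 3.6 (i) p. 36 ("If, moreover, `D` is of FSMFF- and RC-iso-subanchor type, then `C^Λ`
is of rationally standard type") with its proof p. 38 ll. 14–16: "it is immediate from the construction
of `C^Λ` that `C^Λ` is of metrically trivial, [strictly] rational, and birationally Frobenius-normalized
type" [cite: MochizukiFrdII2008, Thm 3.6 (i) p.36]; [FrdI] Def. 4.5 (i) p. 86 (birationally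
Frobenius-normalized), Def. 4.5 (iii)(a) p. 86 (clause of "rationally standard").

PROOF-ONLY (no `def`; cell abc-iut, seat abc-iut-L1-t9 = typer of the schema `Thm36i_rationallyStandard`,
sub-DAG row T36-L06).  The clause "birationally Frobenius-normalized" of Def. 4.5 (iii)(a) for the
archimedean Frobenioid `C = C₀ ×_{D₀} D` of Example 3.3 over ANY base `π : D → D₀` for which `C` is a
Frobenioid (hypothesis `hF`; discharged for connected, totally epimorphic `D` by `Ex33ii_isFrobenioid_holds`),
at THE birationalization `PreFrobenioid.biratData hF hsq` (abc-iut-L6-t8 / L6-t6):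
* `ArchFrd.C0.exists_shrink_restrict` — the construction-level fact: in `C₀`, if `δ = (f, 1, c₁)` is
  naively co-angular and `ν = (f, n, c₂)` has the same base, then for a small positive real `r` the radial
  shrink `ρ = (id, 1, r)` and `ε = (id, n, c₂ rⁿ / c₁)` are endomorphisms of the source with
  `ρ ≫ ν = ε ≫ δ` (angular condition from the co-angularity of `δ`, radial condition by taking `r` small);
* `ArchFrd.C.exists_shrink_restrict` — the same in `C = C₀ ×_{D₀} D` (lift with identity `D`-components);
* `ArchFrd.C.isBiratFrobeniusNormalized` / **`ArchFrd.C.isOfBiratFrobeniusNormalizedType`** — by the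
  generic criterion `PreFrobenioid.Birat.isBiratFrobeniusNormalized_of_restrictions`
  (`BiratFrobeniusNormalizedCriterion.lean`) and abc-iut-w4-d092's `C.isOfFrobeniusNormalizedType`
  (`C` is of Frobenius-normalized type), every object of `C` is birationally Frobenius-normalized; stated
  in both tree forms (functor-level and for abc-iut-L1-t3's `PreFrobenioidData.IsOfBiratFrobeniusNormalizedType`
  at `biratData hF hsq`, via `isBiratFrobeniusNormalized_iff_biratData`).
No statement of the paper is strengthened; nothing here bears on [IUTchIII] Cor. 3.12.
-/

noncomputable section

namespace Literature.AlgebraicGeometry.Frobenioids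

open CategoryTheory Opposite
open scoped Pointwise

universe v u

namespace ArchFrd

namespace C0

variable {S Y : C0}

/-- The identity of `D₀` acts trivially on scalars. [cite: MochizukiFrdII2008, Def 3.1 (i) p.23] -/
private theorem act_id_apply (K : D0) (c : ℂˣ) : D0.Hom.act (𝟙 K) c = c := by
  unfold D0.Hom.act
  rw [D0.twists_id, D0.galAct_false]

/-- **"Immediate from the construction" (FrdII p. 38 l. 15), in `C₀`**: let `δ = (f, 1, c₁) : S → Y` be
naively co-angular and `ν = (f, n, c₂) : S → Y` have the same base arrow. Then there are a positive real
radial shrink `ρ = (id, 1, r)` and an endomorphism `ε = (id, n, c₂ rⁿ c₁⁻¹)` of `S` with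
`ρ ≫ ν = ε ≫ δ`. [cite: MochizukiFrdII2008, Thm 3.6 (i) p.36] -/
theorem exists_shrink_restrict (δ ν : S ⟶ Y) (hδ1 : degFr δ = 1) (hδco : IsNaivelyCoAngular δ)
    (hb : Base ν = Base δ) :
    ∃ ρ ε : S ⟶ S, Base ρ = 𝟙 _ ∧ degFr ρ = 1 ∧ Base ε = 𝟙 _ ∧ ρ ≫ ν = ε ≫ δ := by
  -- the region `A_K|_L` of `Y` pulled back along `f = Base δ`
  obtain ⟨A', hA', hA't, -, -⟩ := exists_pulledRegion Y (Base δ)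
  have hcν := hom_conditions ν (A' := A') (by rw [hb]; exact hA')
  -- positivity bookkeeping
  have ht : 0 < S.tip := S.tip_pos
  have hc₁ : 0 < ‖(scalar δ : ℂ)‖ := norm_pos_iff.mpr (scalar δ).ne_zero
  have hc₂ : 0 < ‖(scalar ν : ℂ)‖ := norm_pos_iff.mpr (scalar ν).ne_zero
  -- the shrinking factor `r = min(1, K)`, `K = tip · ‖c₁‖ / (‖c₂‖ · tipⁿ)`
  set K : ℝ := S.tip * ‖(scalar δ : ℂ)‖ / (‖(scalar ν : ℂ)‖ * S.tip ^ (degFr ν : ℕ)) with hK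
  have hKpos : 0 < K := div_pos (mul_pos ht hc₁) (mul_pos hc₂ (pow_pos ht _))
  let r : PosReal := ⟨min 1 K, lt_min one_pos hKpos⟩
  have hr0 : 0 < (r : ℝ) := r.2
  have hr1 : (r : ℝ) ≤ 1 := min_le_left _ _
  have hrK : (r : ℝ) ≤ K := min_le_right _ _
  have hnr : ‖((ofPosReal ℂ r : ℂˣ) : ℂ)‖ = (r : ℝ) := by
    rw [coe_ofPosReal, RCLike.norm_ofReal, abs_of_pos hr0]
  -- `ρ = (id, 1, r)`
  obtain ⟨ρ, hρb, hρd, hρc⟩ := exists_hom S S (𝟙 S.base) 1 (ofPosReal_mem_scalars r S.base)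
    (A' := S.region) (pullRegion_id S).symm
    (by rw [unitPart_ofPosReal, one_smul, PNat.one_coe, pow_one])
    (by
      rw [hnr, PNat.one_coe, pow_one, ← tip_eq]
      exact mul_le_of_le_one_left ht.le hr1)
  -- `ε = (id, n, e)`, `e = c₂ rⁿ c₁⁻¹`
  set e : ℂˣ := scalar ν * ofPosReal ℂ r ^ (degFr ν : ℕ) * (scalar δ)⁻¹ with he
  have he_mem : e ∈ D0.scalars S.base :=
    mul_mem (mul_mem ν.scalar_mem (pow_mem (ofPosReal_mem_scalars r S.base) _)) (inv_mem δ.scalar_mem)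
  have he_unit : unitPart ℂ e = unitPart ℂ (scalar ν) * (unitPart ℂ (scalar δ))⁻¹ := by
    rw [he, unitPart_mul, unitPart_mul, unitPart_inv, ← map_pow, unitPart_ofPosReal, mul_one]
  have he_norm : ‖(e : ℂ)‖ = ‖(scalar ν : ℂ)‖ * (r : ℝ) ^ (degFr ν : ℕ) * ‖(scalar δ : ℂ)‖⁻¹ := by
    rw [he, Units.val_mul, Units.val_mul, Units.val_pow_eq_pow_val, Units.val_inv_eq_inv_val,
      norm_mul, norm_mul, norm_pow, norm_inv, hnr]
  obtain ⟨ε, hεb, hεd, hεc⟩ := exists_hom S S (𝟙 S.base) (degFr ν) he_mem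
    (A' := S.region) (pullRegion_id S).symm
    (by
      -- angular condition: from the co-angularity of `δ` (complex source) or trivially (real source)
      rcases hS : S.base with _ | _
      · -- real source: the region of `S` is isotropic
        rw [show S.region.dir = Set.univ from S.isIsotropic_of_isReal hS]
        exact Set.subset_univ _
      · -- complex source: `u(c₁) · B_S = B'` (co-angular) and `u(c₂) · B_Sⁿ ⊆ B'`
        have hco : unitPart ℂ (scalar δ) • S.region.dir = A'.dir := by
          have h := hδco hS
          rw [image_unitPart_homImage, hδ1, PNat.one_coe, pow_one] at h
          rw [h, ← hA', A'.image_unitPart_carrier]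
        rw [he_unit, mul_comm, mul_smul]
        refine (Set.smul_set_mono hcν.1).trans ?_
        rw [← hco, inv_smul_smul])
    (by
      -- radial condition: `‖c₂‖ rⁿ ‖c₁‖⁻¹ tipⁿ ≤ tip` since `rⁿ ≤ r ≤ K`
      rw [he_norm, ← tip_eq]
      have hrn : (r : ℝ) ^ (degFr ν : ℕ) ≤ (r : ℝ) :=
        pow_le_of_le_one hr0.le hr1 (PNat.ne_zero _)
      calc ‖(scalar ν : ℂ)‖ * (r : ℝ) ^ (degFr ν : ℕ) * ‖(scalar δ : ℂ)‖⁻¹ * S.tip ^ (degFr ν : ℕ)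
          ≤ ‖(scalar ν : ℂ)‖ * K * ‖(scalar δ : ℂ)‖⁻¹ * S.tip ^ (degFr ν : ℕ) := by
            gcongr
            exact hrn.trans hrK
        _ = S.tip := by
            rw [hK]
            field_simp)
  refine ⟨ρ, ε, hρb, hρd, hεb, hom_ext ?_ ?_ ?_⟩
  · rw [base_comp', base_comp', hρb, hεb, hb]
  · rw [degFr_comp', degFr_comp', hρd, hεd, hδ1, one_mul, mul_one]
  · rw [scalar_comp', scalar_comp', hρb, hεb, hρc, hεc, hδ1, PNat.one_coe, pow_one, act_id_apply,
      act_id_apply, he, mul_comm (scalar δ), inv_mul_cancel_right]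

end C0

variable {D : Type u} [Category.{v} D] (π : D ⥤ D0)

/-- **"Immediate from the construction", in `C = C₀ ×_{D₀} D`**: for a co-angular pre-step
`δ : S → A` of `C` and an arrow `ν : S → A` with the same base arrow in `D`, there are `ρ ∈ O^▷(S)` and
a base-identity endomorphism `ε` of `S` with `ρ ≫ ν = ε ≫ δ` (lift of `C0.exists_shrink_restrict` with
identity `D`-components). [cite: MochizukiFrdII2008, Thm 3.6 (i) p.36] -/
theorem C.exists_shrink_restrict {S A : C π} (δ : S ⟶ A)
    (hδ : PreFrobenioid.IsCoAngularPreStep (C.toElem π) δ) (ν : S ⟶ A)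
    (hν : PreFrobenioid.Base (C.toElem π) ν = PreFrobenioid.Base (C.toElem π) δ) :
    ∃ ρ ε : S ⟶ S, End.of ρ ∈ PreFrobenioid.endSubmonoid (C.toElem π) S ∧
      PreFrobenioid.IsBaseIdentity (C.toElem π) ε ∧ ρ ≫ ν = ε ≫ δ := by
  have hsnd : ν.snd = δ.snd := hν
  -- the `C₀`-components have the same base arrow
  have hb0 : C0.Base ν.fst = C0.Base δ.fst := by
    have h₁ := PreFrobenioid.FiberProduct.hom_w ν
    have h₂ := PreFrobenioid.FiberProduct.hom_w δ
    rw [hsnd, ← h₂] at h₁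
    exact (cancel_mono A.e.hom).mp h₁
  have hδ1 : C0.degFr δ.fst = 1 := hδ.2.1
  have hco : C0.IsNaivelyCoAngular δ.fst := (Ex33ii_coAngular_iff_holds π δ).mp hδ.1
  obtain ⟨ρ₀, ε₀, hρ₀b, hρ₀d, hε₀b, h₀⟩ := C0.exists_shrink_restrict δ.fst ν.fst hδ1 hco hb0
  refine ⟨PreFrobenioid.FiberProduct.liftEnd S ρ₀ hρ₀b, PreFrobenioid.FiberProduct.liftEnd S ε₀ hε₀b,
    ⟨rfl, hρ₀d⟩, rfl, CFP.hom_ext ?_ ?_⟩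
  · rw [CFP.comp_fst, CFP.comp_fst]
    exact h₀
  · rw [CFP.comp_snd, CFP.comp_snd]
    change 𝟙 _ ≫ ν.snd = 𝟙 _ ≫ δ.snd
    rw [hsnd]

/-- **Every object of the archimedean Frobenioid `C` is birationally Frobenius-normalized** ([FrdI] Def.
4.5 (i)) at THE birationalization — for any base `π : D → D₀` over which `C` is a Frobenioid.
[cite: MochizukiFrdII2008, Thm 3.6 (i) p.36] -/
theorem C.isBiratFrobeniusNormalized (hF : PreFrobenioid.IsFrobenioid (C.toElem π))
    (hsq : PreFrobenioid.HasBiratSquares (C.toElem π)) (X : C π) :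
    PreFrobenioid.IsBiratFrobeniusNormalized (C.toElem π) hF hsq X :=
  PreFrobenioid.Birat.isBiratFrobeniusNormalized_of_restrictions X
    (fun T _ _ => (C.isOfFrobeniusNormalizedType π).obj T)
    (fun _ δ hδ ν hν => C.exists_shrink_restrict π δ hδ ν hν)

/-- **[FrdII] Thm. 3.6 (i), clause "birationally Frobenius-normalized" of "rationally standard"
(FrdII p. 38 l. 15) for `C = C^ℤ`, PROVED at THE birationalization `biratData hF hsq`** (abc-iut-L1-t3's
`PreFrobenioidData.IsOfBiratFrobeniusNormalizedType`, Def. 4.5 (i)). [cite: MochizukiFrdII2008, Thm 3.6 (i) p.36] -/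
theorem C.isOfBiratFrobeniusNormalizedType (hF : PreFrobenioid.IsFrobenioid (C.toElem π))
    (hsq : PreFrobenioid.HasBiratSquares (C.toElem π)) :
    PreFrobenioidData.IsOfBiratFrobeniusNormalizedType (PreFrobenioid.biratData hF hsq) :=
  ⟨fun X => (PreFrobenioid.isBiratFrobeniusNormalized_iff_biratData X).mp
    (C.isBiratFrobeniusNormalized π hF hsq X)⟩

end ArchFrd

end Literature.AlgebraicGeometry.Frobenioids
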